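import Mathlib
import Summits.ValiantsHypothesis.ValiantsHypothesis.Theses.NewtonUnitEquations
import Summits.ValiantsHypothesis.ValiantsHypothesis.Theorems.NewtonUnitEquationsTwoProductsFormalLogLinearisationDefs
import Summits.ValiantsHypothesis.ValiantsHypothesis.Theorems.NewtonUnitEquationsTwoProductsFormalLogLinearisationSectorTops
import Summits.ValiantsHypothesis.ValiantsHypothesis.Theorems.NewtonUnitEquationsTwoProductsFormalLogLinearisationStubLogLinearisation
import Literature.Computability.AlgebraicComplexity.NewtonPolygonTau
import Literature.Computability.AlgebraicComplexity.NewtonPolygonTauProductBounds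
import HarnessLib

/-!
# Route NewtonUnitEquations — crux `TwoProducts` (stmt-ValiantsHypothesis-5906), line `formal-log-linearisation`:
# the CONVERSE "engine ⇐ crux" — the log-sum engine (stub 5) is implied by `TwoProducts`

Registered line `Cruxes/TwoProducts/Lines/formal-log-linearisation.lean` (NOT the item's skeleton of record;
helper mode `--supports stmt-ValiantsHypothesis-5906 --as helper`, no stub credit claimed). Vocabulary = the
line's, verbatim, from the ONE Defs file `Theorems/NewtonUnitEquationsTwoProductsFormalLogLinearisationDefs.lean`.

The line reduces the crux `TwoProducts` (`#vert Newt(∏ f − ∏ g) ≤ 2^(a·m)·(t+2)^b` for `t`-sparse factors)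
to its OPEN stub 5 `stub_logSumEngine` = `LogSumEngine`: for tails `u_j, v_j` (zero constant term, `≤ t`
monomials, `t ≥ 2`) every finite set of VISIBLE points of the support of the log-sum
`D = Σ_j log(1+u_j) − Σ_j log(1+v_j)` has `≤ 2^(a·m)·(t+2)^b` elements.  The line's docstring records that this
engine is "equivalent to the crux given stubs 1–3, so NOT a strengthening" — the direction `crux ⇒ engine`
using only stub 3 (`stub_logLinearisation`, LANDED: `Theorems/…FormalLogLinearisationStubLogLinearisation.lean`):
a visible point of `supp D` for a valid weight `ξ` is, by stub 3, the strict `ξ`-top of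
`supp (∏(1+u) − ∏(1+v))`, hence an exposed vertex of the Newton polygon of that difference of two products of
`(t+1)`-sparse factors, and `TwoProducts` counts those.  This file makes that direction a tree theorem:

* `natEmb_mem_extremePoints_of_mem_logVisible` — a visible point of the log-sum is (after the real embedding)
  a vertex of `Newt (tailDiff u v)`;
* `card_le_newtonVertexCount_of_subset_logVisible` — hence every finite set of visible points has at most
  `newtonVertexCount (tailDiff u v)` elements;
* `card_support_one_add_le` — `1 + u` is `(t+1)`-sparse when `u` is `t`-sparse;
* `logSumEngine_of_twoProducts` — **`TwoProducts → LogSumEngine`** (statement = the line's `LogSumEngine` /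
  registered `stub_logSumEngine` body VERBATIM, with `Theses.NewtonUnitEquations.TwoProducts` as hypothesis;
  constants `(a, b) ↦ (a, 2b)` via `t + 3 ≤ (t + 2)²`).

So a refutation of the engine refutes the crux itself (disprover-relevant), and with the line's composition
`TwoProducts_of` (stubs 1–4 landed: p584455, p585375, p584485, p583834) the engine is EXACTLY
crux-equivalent.  Honest framing: bookkeeping converse on a non-record line; the engine `stub_logSumEngine` stays
OPEN, the crux `TwoProducts` stays OPEN, and nothing here is progress on `VP ≠ VNP` (NOT proved). No definitions,
no named facts.
-/

noncomputable section

-- Sub = Summit single-conjunct layout: the duplicated namespace component is mandated by the tree.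
set_option linter.dupNamespace false

namespace Summit.ValiantsHypothesis.ValiantsHypothesis.Theorems.NewtonUnitEquations.TwoProducts.FormalLogLinearisation

open MvPolynomial Literature.Computability.AlgebraicComplexity
open scoped BigOperators

variable {m : ℕ}

/-- A VISIBLE POINT OF THE LOG-SUM IS A NEWTON VERTEX: if `l ∈ logVisible u v` (the strict `ξ`-top of `supp D`
for some valid weight `ξ`) and the tails have zero constant terms, then the real embedding of `l` is an extreme
point of the convex hull of the embedded support of `tailDiff u v = ∏(1+u_j) − ∏(1+v_j)` — by stub 3
(`stub_logLinearisation`) `l` is the strict `ξ`-top of that support, and a strict top is an exposed, hence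
extreme, point (`KPTT.PlanarMinkowski.IsStrictTop.mem_extremePoints`). [folklore] -/
theorem natEmb_mem_extremePoints_of_mem_logVisible (u v : Fin m → MvPolynomial (Fin 2) ℂ)
    (hu : ∀ j, coeff 0 (u j) = 0) (hv : ∀ j, coeff 0 (v j) = 0) {l : Expo} (hl : l ∈ logVisible u v) :
    (fun i : Fin 2 => ((l i : ℕ) : ℝ)) ∈
      (convexHull ℝ ((fun e : Expo => fun i : Fin 2 => ((e i : ℕ) : ℝ)) ''
        ((tailDiff u v).support : Set Expo))).extremePoints ℝ := by
  classical
  obtain ⟨ξ, hξ, htop⟩ := hl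
  have htop' : IsStrictTop ξ ↑(tailDiff u v).support l :=
    (stub_logLinearisation m u v hu hv ξ hξ l).mpr htop
  have hplanar := (isStrictTop_iff_planar ξ (tailDiff u v).support l).mp htop'
  have hmem := hplanar.mem_extremePoints
  rwa [Finset.coe_image] at hmem

/-- COUNT: every finite set of visible points of the log-sum has at most `newtonVertexCount (tailDiff u v)`
elements (inject by the real embedding into the vertex set of the Newton polygon, which is finite as a subset of
the embedded support). [folklore] -/
theorem card_le_newtonVertexCount_of_subset_logVisible (u v : Fin m → MvPolynomial (Fin 2) ℂ)
    (hu : ∀ j, coeff 0 (u j) = 0) (hv : ∀ j, coeff 0 (v j) = 0) (S : Finset Expo)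
    (hS : (↑S : Set Expo) ⊆ logVisible u v) : S.card ≤ newtonVertexCount (tailDiff u v) := by
  classical
  set emb : Expo → (Fin 2 → ℝ) := fun e i => ((e i : ℕ) : ℝ) with hemb
  set E : Set (Fin 2 → ℝ) :=
    (convexHull ℝ (emb '' ((tailDiff u v).support : Set Expo))).extremePoints ℝ with hE
  -- the vertex set is finite: it lies in the embedded support
  have hEsub : E ⊆ emb '' ((tailDiff u v).support : Set Expo) :=
    extremePoints_convexHull_subset
  have hEfin : E.Finite := ((tailDiff u v).support.finite_toSet.image emb).subset hEsub
  -- the embedded `S` lies in the vertex set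
  have hSE : (↑(S.image emb) : Set (Fin 2 → ℝ)) ⊆ E := by
    intro x hx
    obtain ⟨l, hl, rfl⟩ := Finset.mem_image.mp (Finset.mem_coe.mp hx)
    exact natEmb_mem_extremePoints_of_mem_logVisible u v hu hv (hS (Finset.mem_coe.mpr hl))
  have hinj : Function.Injective emb := natEmb_injective
  calc S.card = (S.image emb).card := (Finset.card_image_of_injective S hinj).symm
    _ = (↑(S.image emb) : Set (Fin 2 → ℝ)).ncard := (Set.ncard_coe_finset _).symm
    _ ≤ E.ncard := Set.ncard_le_ncard hSE hEfin
    _ = newtonVertexCount (tailDiff u v) := rfl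

/-- SPARSITY SHIFT: if `u` has at most `t` monomials then `1 + u` has at most `t + 1`. [folklore] -/
theorem card_support_one_add_le (u : MvPolynomial (Fin 2) ℂ) {t : ℕ} (h : u.support.card ≤ t) :
    (1 + u).support.card ≤ t + 1 := by
  classical
  calc (1 + u).support.card ≤ ((1 : MvPolynomial (Fin 2) ℂ).support ∪ u.support).card :=
        Finset.card_le_card (support_add (p := (1 : MvPolynomial (Fin 2) ℂ)) (q := u))
    _ ≤ (1 : MvPolynomial (Fin 2) ℂ).support.card + u.support.card := Finset.card_union_le _ _
    _ ≤ 1 + t := by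
        gcongr
        calc (1 : MvPolynomial (Fin 2) ℂ).support.card ≤ ({0} : Finset Expo).card :=
              Finset.card_le_card (support_one.trans_subset le_rfl)
          _ = 1 := Finset.card_singleton _
    _ = t + 1 := add_comm _ _

/-- The products of the shifted factors are the line's `tailDiff`: `∏ (1 + u_j) − ∏ (1 + v_j) = tailDiff u v`.
[folklore] -/
theorem prod_one_add_sub_prod_one_add_eq_tailDiff (u v : Fin m → MvPolynomial (Fin 2) ℂ) :
    ∏ j, (fun j => 1 + u j) j - ∏ j, (fun j => 1 + v j) j = tailDiff u v := rfl

/-- `t + 3 ≤ (t + 2)²`, the arithmetic behind the constants `(a, b) ↦ (a, 2b)`. [folklore] -/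
theorem add_three_le_sq (t : ℕ) : t + 1 + 2 ≤ (t + 2) ^ 2 := by nlinarith

/-- **ENGINE ⇐ CRUX.** The crux `TwoProducts` implies the line's log-sum engine `LogSumEngine` (the body of the
registered OPEN stub `stub_logSumEngine`, verbatim): given the crux with constants `(a, b)`, a finite set `S` of
visible points of `supp (Σ log(1+u_j) − Σ log(1+v_j))` for `t`-sparse tails injects into the vertices of
`Newt (∏(1+u_j) − ∏(1+v_j))` (stub 3 + exposed ⇒ extreme), a difference of two products of `(t+1)`-sparse
factors, so `#S ≤ 2^(a·m)·(t+3)^b ≤ 2^(a·m)·(t+2)^(2b)`.  Consequently the engine is NOT a strengthening of the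
crux: refuting it refutes `TwoProducts`.  (The hypothesis `2 ≤ t` of the engine is not used.) [folklore] -/
theorem logSumEngine_of_twoProducts (h : Theses.NewtonUnitEquations.TwoProducts) :
    ∃ a b : ℕ, ∀ (m t : ℕ), 2 ≤ t → ∀ (u v : Fin m → MvPolynomial (Fin 2) ℂ),
      (∀ j, coeff 0 (u j) = 0 ∧ (u j).support.card ≤ t) → (∀ j, coeff 0 (v j) = 0 ∧ (v j).support.card ≤ t) →
        ∀ S : Finset Expo, (↑S ⊆ logVisible u v) → S.card ≤ 2 ^ (a * m) * (t + 2) ^ b := by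
  obtain ⟨a, b, hab⟩ := h
  refine ⟨a, 2 * b, fun m t _ u v hu hv S hS => ?_⟩
  -- the crux applied to the shifted factors `1 + u_j`, `1 + v_j` (each `(t+1)`-sparse)
  have hcrux := hab m (t + 1) (fun j => 1 + u j) (fun j => 1 + v j)
    (fun j => card_support_one_add_le (u j) (hu j).2) (fun j => card_support_one_add_le (v j) (hv j).2)
  rw [prod_one_add_sub_prod_one_add_eq_tailDiff] at hcrux
  -- `#S ≤ #vert Newt(tailDiff u v)`
  have hS' := card_le_newtonVertexCount_of_subset_logVisible u v (fun j => (hu j).1) (fun j => (hv j).1) S hS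
  -- arithmetic: `2^(am) (t+3)^b ≤ 2^(am) (t+2)^(2b)`
  have hpow : (t + 1 + 2) ^ b ≤ (t + 2) ^ (2 * b) := by
    rw [pow_mul]
    exact Nat.pow_le_pow_left (add_three_le_sq t) b
  calc S.card ≤ newtonVertexCount (tailDiff u v) := hS'
    _ ≤ 2 ^ (a * m) * (t + 1 + 2) ^ b := hcrux
    _ ≤ 2 ^ (a * m) * (t + 2) ^ (2 * b) := Nat.mul_le_mul_left _ hpow

end Summit.ValiantsHypothesis.ValiantsHypothesis.Theorems.NewtonUnitEquations.TwoProducts.FormalLogLinearisation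

end
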